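import Summits.Ventures.CertifiedManyBodySolver.Observables.MeanFieldClassExclusionObjectE
import Summits.Ventures.CertifiedManyBodySolver.Certificates.HubbardSquare_n1_upper_pb2_U16_row469
import Literature.MathematicalPhysics.QuantumLattice.HubbardFermiSeaTangentRowsHigh
import HarnessLib

/-!
# Ventures/CertifiedManyBodySolver — Observables/PolarisedClassExclusionObjectE.lean

HONEST FRAMING: first certified bounds; not a superconductivity verdict; every number certified or labelled float.
A competing-order EXCLUSION removes a named class of candidate ground states; it never says which order is present;
no phase sentence follows.

Cell `hubbard-tc` (MO-S3, D-0096), seat `hubbard-tc-mod-3` (G3), `prover-hubbard-tc-mod-3-g3-0`. The SATURATED-FERROMAGNET column of the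
seat's EXCLUSION-TABLE (§B‴, so far cert-num only) made kernel, in the ENERGY vocabulary of the tree. A fully spin-polarised state of
density `n` (total spin `S = S_max`; in any `S^z` sector, by `SU(2)` invariance) has no double occupancy, so its energy density at EVERY `U`
is its one-species kinetic energy, which the bathtub principle bounds below by the one-species Fermi-sea value
`F¹(n, t′) = ½·e(1, t′, 0, 2n)` (each species of the free two-species gas at density `2n` fills the one-species sea of density `n`;
Lieb–Loss 1993 §8; Tasaki 1998 §2 Def. 2.1 and Thm. 6.1: saturated ferromagnetism ⇔ `E_min(S_max) < E_min(S)` for all `S < S_max`, and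
`E_min(S_max)` = the sum of the lowest `N_e` one-electron levels, independent of `U`). Hence a certified cap on the GS energy density
STRICTLY BELOW `½·e(1, t′, 0, 2n)` excludes the saturated-FM class as ground state — the inequality proved here,

  `energyDensityTT' 1 t′ U n < ½ · energyDensityTT' 1 t′ 0 (2n)`,

is that statement in the tree's vocabulary (docstring reading; the THEOREM is the strict energy inequality, exactly as the docc words of
`MeanFieldClassExclusion*.lean` carry the Hartree–Fock/BCS reading). Since `e` is nondecreasing in `U`, an FM word holds DOWNWARD in `U`
(«for every `0 ≤ U ≤ U₂`»), the mirror image of the MF words. Devices: the high-density tangent Fermi-sea rows of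
`HubbardFermiSeaTangentRowsHigh` (kernel `decide`, touch `2n₀ ∈ {7/4, 9/5, 93/50, 199/100}`) read between columns by concavity in `t′`
(`objE_floor_between`); caps = the CERTIFIED #469 half-filling cap at `U = 16` (`t′`-even + concave, vacuum chord) for the near-half-filled
boxes, and at `U = 8` the `t′`-chord cap of `MeanFieldClassExclusionObjectE` (`t′ ≤ −1/4`, #473 ∧ #445) or the kinematic transport of #445
(`t′ ≥ −1/4`), density / vacuum chords to the #472 half-filling cap, linearised in `(n, t′)`.

* `laE_x0_lt_polarised_of` — La₂CuO₄ (M13) BOX #18 object E, hole half `n ∈ [0.99, 1)`, `t′ ∈ [−3/10, −1/5]`: WHOLE box (every `U ≤ 16` ⊇ `[7.9, 14.7]`), cond. #469; margin `+0.22`;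
* `ccocE_parent_lt_polarised_of` — Ca₂CuO₂Cl₂ (M58) BOX #28, `t′ ∈ [−41/100, −3/10]`: WHOLE box (`U ≤ 16` ⊇ `[7.1, 12.4]`), cond. #469; `+0.21`;
* `laE_x007_lt_polarised_of` — La x = 0.07 (M14) `n ∈ [0.91, 0.95]`: every `U ≤ 8` (box `[7.9, 14.7]`; cert-num `U ≤ 10.1`), cond. #445 ∧ #473 ∧ #472; `+0.09`;
* `laE_x0125_lt_polarised_of` — La x = ⅛ (M15) `n ∈ [0.855, 0.895]`: every `U ≤ 8` (cert-num `8.6`); `+0.04`;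
* `ccocE_x010_lt_polarised_of` — Na-CCOC (M36) `n ∈ [0.88, 0.92]`, `t′ ∈ [−41/100, −3/10]`: every `U ≤ 8` (cert-num `8.3`); `+0.03`.

WHAT THIS IS NOT: a statement about partially polarised (unsaturated) ferromagnetism, stripes, d-wave order or T_c; tight. The other
boxes of record (NdNiO₂, Hg1201, R-nickelates at `n ≤ 0.9` with `|t′/t_eff| ≥ 0.35`) carry NO FM exclusion (the cert-num test fails there too).

References: E. H. Lieb, M. Loss, Duke Math. J. 71 (1993) 337, §8 Thm 8.2 [LiebLoss1993]; H. Tasaki, J. Phys.: Condens. Matter 10 (1998)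
4353, §2 (Def. 2.1), §6 (Thm. 6.1) [Tasaki1998]; R. B. Israel, Convexity in the Theory of Lattice Gases (1979), Thm I.3.4 [Israel1979];
D. Ruelle, Statistical Mechanics (1969) §3.3 [Ruelle1969].
-/

noncomputable section

namespace Summit.Ventures.CertifiedManyBodySolver.Observables

open Literature.MathematicalPhysics.QuantumLattice
open Literature.MathematicalPhysics.QuantumLattice.ThermodynamicLimit
open Summit.Ventures.CertifiedManyBodySolver.Certificates
open Matrix HubbardWave0 Literature.Probability.LatticeModels Filter Topology
open scoped ComplexOrder BigOperators


/-! ### §1 Devices -/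

/-- **Half-filling cap at `U = 16`, every `t′`**: `e(1, t′, 16, 1) ≤ −0.2788435215` (CERTIFIED #469 at `t′ = 0`; `t′`-even + concave at
half filling). [cite: Israel1979, Thm. I.3.4] -/
theorem polar_halfFilling_cap16 (h469 : cert_r469_pb2_tl_upper_n1_U16) (t' : ℝ) :
    energyDensityTT' 1 t' 16 1 ≤ -0.2788435215 := by
  have h := m2_U16_upper_r469_print h469
  have h0 : energyDensityTT' 1 0 16 1 ≤ -0.2788435215 := by
    rw [energyDensityTT'_zero]
    refine h.trans ?_
    push_cast
    norm_num
  exact (energyDensityTT'_one_le_tPrime_zero 1 t' (by norm_num : (0 : ℝ) ≤ 16)).trans h0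

/-- **Vacuum chord at `U = 16`**: `e(1, s, 16, 1) ≤ C` gives `e(1, s, 16, n) ≤ n·C` for `0 < n < 1` (convexity in the density, `e(0) ≤ 0`).
[cite: Ruelle1969, §3.3] -/
theorem polar_half_cap16 {s n C : ℝ} (hC : energyDensityTT' 1 s 16 1 ≤ C) (hn : 0 < n) (hn1 : n < 1) :
    energyDensityTT' 1 s 16 n ≤ n * C := by
  have hv := energyDensityTT'_le_vacuum_chord 1 s (by norm_num : (0 : ℝ) ≤ 16) hn hn1 (by norm_num) hC
  rw [div_one] at hv
  exact hv

/-- **Kinematic cap at `n = 7/8`, `U = 8` on the near side of the `−1/4` anchor**: for `s ≥ −1/4`,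
`e(1, s, 8, 7/8) ≤ −0.2813417849 + 1.6212·s` (CERTIFIED #445 transported by `|e(s) − e(−1/4)| ≤ 1.6212|s + 1/4|`, `strip78_cap_of_anchor`).
[cite: Israel1979, Thm. I.3.4] -/
theorem polar_kin78_cap8 (h445 : cert_dbt329pair_allk) {s : ℝ} (hs : -1 / 4 ≤ s) :
    energyDensityTT' 1 s 8 (7 / 8) ≤ -0.2813417849 + 1.6212 * s := by
  have h := strip78_cap_of_anchor (m3_tpm1o4_cap_decimal_of h445) s (by norm_num : (0 : ℝ) ≤ 8)
  rw [show s - -1 / 4 = s + 1 / 4 by ring, abs_of_nonneg (by linarith : 0 ≤ s + 1 / 4), sub_self, max_self,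
    mul_zero, add_zero] at h
  linarith

/-- **Low-band cap at `U = 8` when `B·s ≤ 0`**: `e(1, s, 8, 7/8) ≤ A + B·s`, `0 < m ≤ n ≤ 7/8` give `e(1, s, 8, n) ≤ (8/7)(A·n + B·m·s)`
(vacuum chord; `n·(Bs) ≤ m·(Bs)`). [cite: Ruelle1969, §3.3] -/
theorem polar_lowBand_cap8_neg {s n m A B : ℝ} (hR : energyDensityTT' 1 s 8 (7 / 8) ≤ A + B * s) (hBs : B * s ≤ 0)
    (hm : 0 < m) (hmn : m ≤ n) (hn : n ≤ 7 / 8) :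
    energyDensityTT' 1 s 8 n ≤ 8 / 7 * (A * n + B * m * s) := by
  have h2 : B * s * n ≤ B * m * s := by nlinarith [mul_nonneg (neg_nonneg.2 hBs) (sub_nonneg.2 hmn)]
  have hlin : n / (7 / 8) * (A + B * s) ≤ 8 / 7 * (A * n + B * m * s) := by
    have e : n / (7 / 8) * (A + B * s) = 8 / 7 * (A * n + B * s * n) := by ring
    rw [e]
    linarith
  have hn0 : 0 < n := lt_of_lt_of_le hm hmn
  rcases eq_or_lt_of_le hn with h78 | h78
  · rw [h78] at hlin ⊢
    have e : (7 / 8 : ℝ) / (7 / 8) * (A + B * s) = A + B * s := by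
      rw [div_self (by norm_num : (7 / 8 : ℝ) ≠ 0), one_mul]
    rw [e] at hlin
    exact hR.trans hlin
  · have hv := energyDensityTT'_le_vacuum_chord 1 s (by norm_num : (0 : ℝ) ≤ 8) hn0 h78 (by norm_num) hR
    exact hv.trans hlin

/-- **High-band cap at `U = 8` when `B·s ≤ 0`**: `e(1, s, 8, 7/8) ≤ A + B·s`, `e(1, s, 8, 1) ≤ C`, `7/8 < n < 1`, `n ≤ m` give
`e(1, s, 8, n) ≤ 8((1 − n)A + (1 − m)(Bs) + (n − 7/8)C)` (density chord; `(1 − n)(Bs) ≤ (1 − m)(Bs)`). [cite: Ruelle1969, §3.3] -/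
theorem polar_highBand_cap8_neg {s n m A B C : ℝ} (hR : energyDensityTT' 1 s 8 (7 / 8) ≤ A + B * s)
    (hC : energyDensityTT' 1 s 8 1 ≤ C) (hBs : B * s ≤ 0) (hnm : n ≤ m) (h78 : 7 / 8 < n) (hn1 : n < 1) :
    energyDensityTT' 1 s 8 n ≤ 8 * ((1 - n) * A + (1 - m) * (B * s) + (n - 7 / 8) * C) := by
  have hd := energyDensityTT'_le_density_chord 1 s (by norm_num : (0 : ℝ) ≤ 8) (n₁ := 7 / 8) (n := n) (n₂ := 1)
    (by norm_num) h78 hn1 (by norm_num) hR hC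
  have e1 : ((1 - n) * (A + B * s) + (n - 7 / 8) * C) / (1 - 7 / 8) =
      8 * ((1 - n) * A + (1 - n) * (B * s) + (n - 7 / 8) * C) := by ring
  rw [e1] at hd
  have h2 : (1 - n) * (B * s) ≤ (1 - m) * (B * s) := by nlinarith [mul_nonneg (sub_nonneg.2 hnm) (neg_nonneg.2 hBs)]
  linarith

/-- **The polarised-class word from a cap and a floor**: `0 ≤ U ≤ U₂`, a cap `e(1, t′, U₂, n) ≤ cap`, a floor
`min Fa Fb ≤ e(1, t′, 0, 2n)` and the two linear margins `cap < ½Fa`, `cap < ½Fb` give `e(1, t′, U, n) < ½·e(1, t′, 0, 2n)` (monotonicity in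
`U`). [cite: Tasaki1998, §6, Theorem 6.1] -/
theorem polar_word_of_cap {t' U U₂ n cap Fa Fb : ℝ} (hU0 : 0 ≤ U) (hU : U ≤ U₂) (hn0 : 0 ≤ n) (hn2 : n < 2)
    (hcap : energyDensityTT' 1 t' U₂ n ≤ cap) (hfl : min Fa Fb ≤ energyDensityTT' 1 t' 0 (2 * n))
    (h1 : cap < 1 / 2 * Fa) (h2 : cap < 1 / 2 * Fb) :
    energyDensityTT' 1 t' U n < 1 / 2 * energyDensityTT' 1 t' 0 (2 * n) := by
  have hm := energyDensityTT'_mono_U 1 t' hn0 hn2 hU0 hU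
  have hmin : cap < 1 / 2 * min Fa Fb := by
    rcases min_choice Fa Fb with h | h <;> rw [h] <;> assumption
  linarith


/-! ### §2 The polarised-class words -/

/-- **La₂CuO₄ (VSET M13), BOX #18 object E, hole half `n ∈ [0.99, 1)`: the SATURATED-FM class is excluded on the WHOLE box** —
for `t′ ∈ [−3/10, −1/5]` and every `0 ≤ U ≤ 16` (the box is `U/t_eff ∈ [7.9, 14.7]`), `e(1, t′, U, n) < ½·e(1, t′, 0, 2n)` = the one-species
bathtub floor of every fully polarised state. Cap = vacuum chord of the CERTIFIED #469 half-filling cap at `U = 16` (`t′`-even + concave;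
monotone in `U`), floor = tangent rows at `2n₀ = 199/100`; margin `+0.22`. [cite: LiebLoss1993, §8, Theorem 8.2] [cite: Tasaki1998, §2 Def. 2.1, §6 Thm. 6.1] [cite: Israel1979, Thm. I.3.4] -/
theorem laE_x0_lt_polarised_of (h469 : cert_r469_pb2_tl_upper_n1_U16)
    {t' U n : ℝ} (ht1 : -3 / 10 ≤ t') (ht2 : t' ≤ -1 / 5) (hU0 : 0 ≤ U) (hU : U ≤ 16)
    (hn1 : 99 / 100 ≤ n) (hn2 : n < 1) :
    energyDensityTT' 1 t' U n < 1 / 2 * energyDensityTT' 1 t' 0 (2 * n) := by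
  have hn0 : (0 : ℝ) ≤ n := by linarith
  have hn2' : n < 2 := by linarith
  have hnpos : (0 : ℝ) < n := by linarith
  have h2n0 : (0 : ℝ) ≤ 2 * n := by linarith
  have h2n2 : 2 * n < 2 := by linarith
  have hC16 := polar_halfFilling_cap16 h469 t'
  have hcap := polar_half_cap16 hC16 hnpos (by linarith)
  have ra := fermiSeaTangentRow_tPrime_neg_three_div_ten_at_hundredninetynine_div_hundred (U := 0) le_rfl h2n0 h2n2
  have rb := fermiSeaTangentRow_tPrime_neg_one_div_four_at_hundredninetynine_div_hundred (U := 0) le_rfl h2n0 h2n2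
  have rc := fermiSeaTangentRow_tPrime_neg_one_div_five_at_hundredninetynine_div_hundred (U := 0) le_rfl h2n0 h2n2
  rcases le_or_gt t' (-1 / 4) with hp | hp
  · -- piece `t' ∈ [-3 / 10, -1 / 4]`
    have hfl := objE_floor_between (s := t') h2n0 h2n2 (by norm_num : (-3 / 10 : ℝ) ≤ -1 / 4) ra rb (by linarith) (by linarith)
    exact polar_word_of_cap hU0 hU hn0 hn2' hcap hfl (by linarith) (by linarith)
  · -- `t' > -1 / 4`
    have hfl := objE_floor_between (s := t') h2n0 h2n2 (by norm_num : (-1 / 4 : ℝ) ≤ -1 / 5) rb rc (by linarith) (by linarith)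
    exact polar_word_of_cap hU0 hU hn0 hn2' hcap hfl (by linarith) (by linarith)

/-- **Ca₂CuO₂Cl₂ parent (M58), BOX #28 object E, hole half `n ∈ [0.99, 1)`: saturated-FM class excluded on the WHOLE box** —
`t′ ∈ [−41/100, −3/10]`, every `0 ≤ U ≤ 16` (box `[7.1, 12.4]`); cap via #469, floor = tangent rows at `2n₀ = 199/100` on the columns `−1/2, −2/5, −3/10`;
margin `+0.21`. [cite: LiebLoss1993, §8, Theorem 8.2] [cite: Tasaki1998, §2 Def. 2.1, §6 Thm. 6.1] [cite: Israel1979, Thm. I.3.4] -/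
theorem ccocE_parent_lt_polarised_of (h469 : cert_r469_pb2_tl_upper_n1_U16)
    {t' U n : ℝ} (ht1 : -41 / 100 ≤ t') (ht2 : t' ≤ -3 / 10) (hU0 : 0 ≤ U) (hU : U ≤ 16)
    (hn1 : 99 / 100 ≤ n) (hn2 : n < 1) :
    energyDensityTT' 1 t' U n < 1 / 2 * energyDensityTT' 1 t' 0 (2 * n) := by
  have hn0 : (0 : ℝ) ≤ n := by linarith
  have hn2' : n < 2 := by linarith
  have hnpos : (0 : ℝ) < n := by linarith
  have h2n0 : (0 : ℝ) ≤ 2 * n := by linarith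
  have h2n2 : 2 * n < 2 := by linarith
  have hC16 := polar_halfFilling_cap16 h469 t'
  have hcap := polar_half_cap16 hC16 hnpos (by linarith)
  have ra := fermiSeaTangentRow_tPrime_neg_one_div_two_at_hundredninetynine_div_hundred (U := 0) le_rfl h2n0 h2n2
  have rb := fermiSeaTangentRow_tPrime_neg_two_div_five_at_hundredninetynine_div_hundred (U := 0) le_rfl h2n0 h2n2
  have rc := fermiSeaTangentRow_tPrime_neg_three_div_ten_at_hundredninetynine_div_hundred (U := 0) le_rfl h2n0 h2n2
  rcases le_or_gt t' (-2 / 5) with hp | hp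
  · -- piece `t' ∈ [-41 / 100, -2 / 5]`
    have hfl := objE_floor_between (s := t') h2n0 h2n2 (by norm_num : (-1 / 2 : ℝ) ≤ -2 / 5) ra rb (by linarith) (by linarith)
    exact polar_word_of_cap hU0 hU hn0 hn2' hcap hfl (by linarith) (by linarith)
  · -- `t' > -2 / 5`
    have hfl := objE_floor_between (s := t') h2n0 h2n2 (by norm_num : (-2 / 5 : ℝ) ≤ -3 / 10) rb rc (by linarith) (by linarith)
    exact polar_word_of_cap hU0 hU hn0 hn2' hcap hfl (by linarith) (by linarith)

/-- **La₁.₉₃Sr₀.₀₇CuO₄ (M14), object E `n ∈ [0.91, 0.95]`, `t′ ∈ [−3/10, −1/5]`: saturated-FM class excluded for every `0 ≤ U ≤ 8`**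
(the box is `[7.9, 14.7]`; the seat's cert-num word with the docc-tangent in `U` reaches `U ≤ 10.1`). Cap at `U = 8` = density chord between the `7/8` cap
(`t′`-chord #473 ∧ #445 for `t′ ≤ −1/4`, kinematic transport of #445 for `t′ ≥ −1/4`) and the half-filling cap #472; floor = tangent rows at `2n₀ = 93/50`;
margin `+0.09`. [cite: LiebLoss1993, §8, Theorem 8.2] [cite: Tasaki1998, §2 Def. 2.1, §6 Thm. 6.1] [cite: Israel1979, Thm. I.3.4] -/
theorem laE_x007_lt_polarised_of (h445 : cert_dbt329pair_allk)
    (h473 : cert_r473_bs_M3U8tp0_w3_b4_R2_ob5p2_kry1_kry2c3rel_hanK7B4D4_KN4_PR20d4_hanK8c2s_hanK8B4D4_uprime)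
    (h472 : cert_r472_pb2_tl_upper_n1_U8)
    {t' U n : ℝ} (ht1 : -3 / 10 ≤ t') (ht2 : t' ≤ -1 / 5) (hU0 : 0 ≤ U) (hU : U ≤ 8)
    (hn1 : 91 / 100 ≤ n) (hn2 : n ≤ 19 / 20) :
    energyDensityTT' 1 t' U n < 1 / 2 * energyDensityTT' 1 t' 0 (2 * n) := by
  have hn0 : (0 : ℝ) ≤ n := by linarith
  have hn2' : n < 2 := by linarith
  have hnpos : (0 : ℝ) < n := by linarith
  have h2n0 : (0 : ℝ) ≤ 2 * n := by linarith
  have h2n2 : 2 * n < 2 := by linarith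
  have hC8 := objE_halfFilling_cap8 h472 t'
  have ra := fermiSeaTangentRow_tPrime_neg_three_div_ten_at_ninetythree_div_fifty (U := 0) le_rfl h2n0 h2n2
  have rb := fermiSeaTangentRow_tPrime_neg_one_div_four_at_ninetythree_div_fifty (U := 0) le_rfl h2n0 h2n2
  have rc := fermiSeaTangentRow_tPrime_neg_one_div_five_at_ninetythree_div_fifty (U := 0) le_rfl h2n0 h2n2
  rcases le_or_gt t' (-1 / 4) with hp | hp
  · -- piece `t' ∈ [-3 / 10, -1 / 4]`
    have hfl := objE_floor_between (s := t') h2n0 h2n2 (by norm_num : (-3 / 10 : ℝ) ≤ -1 / 4) ra rb (by linarith) (by linarith)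
    have hR := objE_conc78_cap8 h445 h473 (s := t') (by linarith)
    have hBs : (0 : ℝ) ≤ -0.6023622600 * t' := mul_nonneg_of_nonpos_of_nonpos (by norm_num) (by linarith)
    have hcap := objE_highBand_cap8 (n := n) hR hC8 hBs (m := 7 / 8) (by linarith) (by linarith) (by linarith)
    exact polar_word_of_cap hU0 hU hn0 hn2' hcap hfl (by linarith) (by linarith)
  · -- `t' > -1 / 4`
    have hfl := objE_floor_between (s := t') h2n0 h2n2 (by norm_num : (-1 / 4 : ℝ) ≤ -1 / 5) rb rc (by linarith) (by linarith)
    have hR := polar_kin78_cap8 h445 (s := t') (by linarith)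
    have hBs : (1.6212 : ℝ) * t' ≤ 0 := mul_nonpos_of_nonneg_of_nonpos (by norm_num) (by linarith)
    have hcap := polar_highBand_cap8_neg (n := n) hR hC8 hBs (m := 19 / 20) hn2 (by linarith) (by linarith)
    exact polar_word_of_cap hU0 hU hn0 hn2' hcap hfl (by linarith) (by linarith)

/-- **La₁.₈₇₅Sr₀.₁₂₅CuO₄ (M15), object E `n ∈ [0.855, 0.895]`, `t′ ∈ [−3/10, −1/5]`: saturated-FM class excluded for every
`0 ≤ U ≤ 8`** (box `[7.9, 14.7]`; cert-num `U ≤ 8.6`). Same devices (low band by the vacuum chord); floor = tangent rows at `2n₀ = 7/4`; margin `+0.04`. [cite: LiebLoss1993, §8, Theorem 8.2] [cite: Tasaki1998, §2 Def. 2.1, §6 Thm. 6.1] [cite: Israel1979, Thm. I.3.4] -/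
theorem laE_x0125_lt_polarised_of (h445 : cert_dbt329pair_allk)
    (h473 : cert_r473_bs_M3U8tp0_w3_b4_R2_ob5p2_kry1_kry2c3rel_hanK7B4D4_KN4_PR20d4_hanK8c2s_hanK8B4D4_uprime)
    (h472 : cert_r472_pb2_tl_upper_n1_U8)
    {t' U n : ℝ} (ht1 : -3 / 10 ≤ t') (ht2 : t' ≤ -1 / 5) (hU0 : 0 ≤ U) (hU : U ≤ 8)
    (hn1 : 171 / 200 ≤ n) (hn2 : n ≤ 179 / 200) :
    energyDensityTT' 1 t' U n < 1 / 2 * energyDensityTT' 1 t' 0 (2 * n) := by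
  have hn0 : (0 : ℝ) ≤ n := by linarith
  have hn2' : n < 2 := by linarith
  have hnpos : (0 : ℝ) < n := by linarith
  have h2n0 : (0 : ℝ) ≤ 2 * n := by linarith
  have h2n2 : 2 * n < 2 := by linarith
  have hC8 := objE_halfFilling_cap8 h472 t'
  have ra := fermiSeaTangentRow_tPrime_neg_three_div_ten_at_seven_div_four (U := 0) le_rfl h2n0 h2n2
  have rb := fermiSeaTangentRow_tPrime_neg_one_div_four_at_seven_div_four (U := 0) le_rfl h2n0 h2n2
  have rc := fermiSeaTangentRow_tPrime_neg_one_div_five_at_seven_div_four (U := 0) le_rfl h2n0 h2n2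
  rcases le_or_gt t' (-1 / 4) with hp | hp
  · -- piece `t' ∈ [-3 / 10, -1 / 4]`
    have hfl := objE_floor_between (s := t') h2n0 h2n2 (by norm_num : (-3 / 10 : ℝ) ≤ -1 / 4) ra rb (by linarith) (by linarith)
    have hR := objE_conc78_cap8 h445 h473 (s := t') (by linarith)
    have hBs : (0 : ℝ) ≤ -0.6023622600 * t' := mul_nonneg_of_nonpos_of_nonpos (by norm_num) (by linarith)
    rcases le_or_gt n (7 / 8) with hb | hb
    · have hcap := objE_lowBand_cap8 hR hBs hnpos hb le_rfl
      exact polar_word_of_cap hU0 hU hn0 hn2' hcap hfl (by linarith) (by linarith)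
    · have hcap := objE_highBand_cap8 hR hC8 hBs (m := 7 / 8) hb.le hb (by linarith)
      exact polar_word_of_cap hU0 hU hn0 hn2' hcap hfl (by linarith) (by linarith)
  · -- `t' > -1 / 4`
    have hfl := objE_floor_between (s := t') h2n0 h2n2 (by norm_num : (-1 / 4 : ℝ) ≤ -1 / 5) rb rc (by linarith) (by linarith)
    have hR := polar_kin78_cap8 h445 (s := t') (by linarith)
    have hBs : (1.6212 : ℝ) * t' ≤ 0 := mul_nonpos_of_nonneg_of_nonpos (by norm_num) (by linarith)
    rcases le_or_gt n (7 / 8) with hb | hb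
    · have hcap := polar_lowBand_cap8_neg hR hBs (m := 171 / 200) (by norm_num) hn1 hb
      exact polar_word_of_cap hU0 hU hn0 hn2' hcap hfl (by linarith) (by linarith)
    · have hcap := polar_highBand_cap8_neg hR hC8 hBs (m := 179 / 200) hn2 hb (by linarith)
      exact polar_word_of_cap hU0 hU hn0 hn2' hcap hfl (by linarith) (by linarith)

/-- **Na-CCOC (M36), BOX #28 object E `n ∈ [0.88, 0.92]`, `t′ ∈ [−41/100, −3/10]`: saturated-FM class excluded for every
`0 ≤ U ≤ 8`** (box `[7.1, 12.4]`; cert-num `U ≤ 8.3`). `t′`-chord cap + density chord to #472; floor = tangent rows at `2n₀ = 9/5`; margin `+0.03`. [cite: LiebLoss1993, §8, Theorem 8.2] [cite: Tasaki1998, §2 Def. 2.1, §6 Thm. 6.1] [cite: Israel1979, Thm. I.3.4] -/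
theorem ccocE_x010_lt_polarised_of (h445 : cert_dbt329pair_allk)
    (h473 : cert_r473_bs_M3U8tp0_w3_b4_R2_ob5p2_kry1_kry2c3rel_hanK7B4D4_KN4_PR20d4_hanK8c2s_hanK8B4D4_uprime)
    (h472 : cert_r472_pb2_tl_upper_n1_U8)
    {t' U n : ℝ} (ht1 : -41 / 100 ≤ t') (ht2 : t' ≤ -3 / 10) (hU0 : 0 ≤ U) (hU : U ≤ 8)
    (hn1 : 22 / 25 ≤ n) (hn2 : n ≤ 23 / 25) :
    energyDensityTT' 1 t' U n < 1 / 2 * energyDensityTT' 1 t' 0 (2 * n) := by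
  have hn0 : (0 : ℝ) ≤ n := by linarith
  have hn2' : n < 2 := by linarith
  have hnpos : (0 : ℝ) < n := by linarith
  have h2n0 : (0 : ℝ) ≤ 2 * n := by linarith
  have h2n2 : 2 * n < 2 := by linarith
  have hC8 := objE_halfFilling_cap8 h472 t'
  have ra := fermiSeaTangentRow_tPrime_neg_one_div_two_at_nine_div_five (U := 0) le_rfl h2n0 h2n2
  have rb := fermiSeaTangentRow_tPrime_neg_two_div_five_at_nine_div_five (U := 0) le_rfl h2n0 h2n2
  have rc := fermiSeaTangentRow_tPrime_neg_three_div_ten_at_nine_div_five (U := 0) le_rfl h2n0 h2n2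
  rcases le_or_gt t' (-2 / 5) with hp | hp
  · -- piece `t' ∈ [-41 / 100, -2 / 5]`
    have hfl := objE_floor_between (s := t') h2n0 h2n2 (by norm_num : (-1 / 2 : ℝ) ≤ -2 / 5) ra rb (by linarith) (by linarith)
    have hR := objE_conc78_cap8 h445 h473 (s := t') (by linarith)
    have hBs : (0 : ℝ) ≤ -0.6023622600 * t' := mul_nonneg_of_nonpos_of_nonpos (by norm_num) (by linarith)
    have hcap := objE_highBand_cap8 (n := n) hR hC8 hBs (m := 7 / 8) (by linarith) (by linarith) (by linarith)
    exact polar_word_of_cap hU0 hU hn0 hn2' hcap hfl (by linarith) (by linarith)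
  · -- `t' > -2 / 5`
    have hfl := objE_floor_between (s := t') h2n0 h2n2 (by norm_num : (-2 / 5 : ℝ) ≤ -3 / 10) rb rc (by linarith) (by linarith)
    have hR := objE_conc78_cap8 h445 h473 (s := t') (by linarith)
    have hBs : (0 : ℝ) ≤ -0.6023622600 * t' := mul_nonneg_of_nonpos_of_nonpos (by norm_num) (by linarith)
    have hcap := objE_highBand_cap8 (n := n) hR hC8 hBs (m := 7 / 8) (by linarith) (by linarith) (by linarith)
    exact polar_word_of_cap hU0 hU hn0 hn2' hcap hfl (by linarith) (by linarith)

end Summit.Ventures.CertifiedManyBodySolver.Observables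

end
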